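import Literature.ModelTheory.ProofTheory.HilbertCalculus
import Literature.ModelTheory.ProofTheory.Checker

/-!
# Completeness of the arithmetised proof checker

Support file for the proof of the enumerability theorem
(`FirstOrder.Language.Theory.IsComputablyAxiomatizable.isRE`; Enderton, *A Mathematical
Introduction to Logic*, §2.5, §3.4–3.5). We show that the checker of
`Literature/ModelTheory/ProofTheory/Checker.lean` accepts a certificate for every theorem: every
syntactic side computation of the Hilbert calculus (lifting, instantiation, closedness,
freshness), every Mathlib term / bounded formula together with its Gödel letters, and every
derivation `Derives U φ` from hypotheses recognised by the axiom oracle can be replayed as a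
sequence of accepted certificate lines (`Certifiable`). Certificates compose by concatenation
because premises are referenced by value (`certOK_append`). Consequently
(`exists_check_of_provable`): if `Provable S (ofBounded φ)` for a sentence `φ`, where every member
of `S` is the translation of a sentence accepted by the oracle, then some certificate for the
Gödel number `encode φ` is accepted.

## Main statements

* `Certifiable.step`, `certOK_append` [folklore];
* `cert_liftT` … `cert_formula`, `cert_derives`, `cert_thm`, `exists_check_of_provable`
  [folklore].

## References

* H. B. Enderton, *A Mathematical Introduction to Logic*, Academic Press (1972), §3.4
  (arithmetization of syntax), §3.5 Thm. 35I.
-/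

namespace Literature.ModelTheory.ProofTheory.PreFOL

open FirstOrder FirstOrder.Language Encodable Denumerable

/-! ### Certifiable judgements -/

section Certifiable

variable (arF arR : ℕ → Option ℕ) (memA : ℕ → Bool)

/-- A judgement numeral is *certifiable* if it occurs in some accepted certificate. [folklore] -/
def Certifiable (j : ℕ) : Prop :=
  ∃ c : List (List ℕ), certOK arF arR memA c = true ∧ j ∈ heads c

variable {arF arR memA}

/-- The line check is monotone in the earlier judgements. [folklore] -/
theorem lineOK_mono {prev prev' line : List ℕ} (h : prev ⊆ prev')
    (hl : lineOK arF arR memA prev line = true) : lineOK arF arR memA prev' line = true := by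
  unfold lineOK at hl ⊢
  simp only [Bool.or_eq_true, Bool.and_eq_true] at hl ⊢
  rcases hl with ((hl | ⟨hl, hC⟩) | ⟨hl, hC⟩) | ⟨hl, hC⟩
  · exact Or.inl (Or.inl (Or.inl (anyOK_mono h hl)))
  · exact Or.inl (Or.inl (Or.inr ⟨Rules.mtFunc.ok_mono h hl, hC⟩))
  · exact Or.inl (Or.inr ⟨Rules.mlRel.ok_mono h hl, hC⟩)
  · exact Or.inr ⟨Rules.pfHyp.ok_mono h hl, hC⟩

/-- **Certificates compose**: the concatenation of two accepted certificates is accepted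
(premises are referenced by value, so the lines of the second certificate still find theirs).
[folklore] -/
theorem certOK_append {c c' : List (List ℕ)} (hc : certOK arF arR memA c = true)
    (hc' : certOK arF arR memA c' = true) : certOK arF arR memA (c ++ c') = true := by
  induction c' using List.reverseRecOn with
  | nil => simpa using hc
  | append_singleton c' l ih =>
      rw [certOK_append_singleton, Bool.and_eq_true] at hc'
      rw [← List.append_assoc, certOK_append_singleton, Bool.and_eq_true, heads_append]
      exact ⟨ih hc'.1, lineOK_mono (List.subset_append_right _ _) hc'.2⟩

/-- Finitely many certifiable judgements occur together in one accepted certificate. [folklore] -/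
theorem Certifiable.of_list : ∀ ps : List ℕ, (∀ p ∈ ps, Certifiable arF arR memA p) →
    ∃ c, certOK arF arR memA c = true ∧ ∀ p ∈ ps, p ∈ heads c
  | [], _ => ⟨[], rfl, by simp⟩
  | p :: ps, h => by
      obtain ⟨c₁, hc₁, hp⟩ := h p (by simp)
      obtain ⟨c₂, hc₂, hps⟩ := Certifiable.of_list ps (fun q hq => h q (by simp [hq]))
      refine ⟨c₁ ++ c₂, certOK_append hc₁ hc₂, fun q hq => ?_⟩
      rw [heads_append, List.mem_append]
      rcases List.mem_cons.1 hq with rfl | hq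
      · exact Or.inl hp
      · exact Or.inr (hps q hq)

/-- **The basic step**: a line that is accepted whenever the judgements `ps` occur earlier
establishes a certifiable judgement as soon as the `ps` are certifiable. [folklore] -/
theorem Certifiable.step (ps : List ℕ) (j : ℕ) (rest : List ℕ)
    (hps : ∀ p ∈ ps, Certifiable arF arR memA p)
    (h : ∀ prev : List ℕ, (∀ p ∈ ps, p ∈ prev) → lineOK arF arR memA prev (j :: rest) = true) :
    Certifiable arF arR memA j := by
  obtain ⟨c, hc, hin⟩ := Certifiable.of_list ps hps
  refine ⟨c ++ [j :: rest], ?_, by simp⟩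
  rw [certOK_append_singleton, hc, Bool.true_and]
  exact h _ hin

/-- Step with no premise. [folklore] -/
theorem Certifiable.step0 (j : ℕ) (rest : List ℕ)
    (h : ∀ prev : List ℕ, lineOK arF arR memA prev (j :: rest) = true) :
    Certifiable arF arR memA j :=
  Certifiable.step [] j rest (by simp) fun prev _ => h prev

/-- Step with one premise (field `1` of the line), extra fields `extra`. [folklore] -/
theorem Certifiable.step1 (j : ℕ) (extra : List ℕ) {p : ℕ} (hp : Certifiable arF arR memA p)
    (h : ∀ prev : List ℕ, p ∈ prev → lineOK arF arR memA prev (j :: p :: extra) = true) :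
    Certifiable arF arR memA j :=
  Certifiable.step [p] j (p :: extra) (by simpa using hp) fun prev hprev => h prev (hprev p (by simp))

/-- Step with two premises (fields `1, 2`). [folklore] -/
theorem Certifiable.step2 (j : ℕ) (extra : List ℕ) {p q : ℕ} (hp : Certifiable arF arR memA p)
    (hq : Certifiable arF arR memA q)
    (h : ∀ prev : List ℕ, p ∈ prev → q ∈ prev → lineOK arF arR memA prev (j :: p :: q :: extra) = true) :
    Certifiable arF arR memA j :=
  Certifiable.step [p, q] j (p :: q :: extra) (by simp [hp, hq]) fun prev hprev =>
    h prev (hprev p (by simp)) (hprev q (by simp))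

/-- Step with three premises (fields `1, 2, 3`). [folklore] -/
theorem Certifiable.step3 (j : ℕ) (extra : List ℕ) {p q u : ℕ} (hp : Certifiable arF arR memA p)
    (hq : Certifiable arF arR memA q) (hu : Certifiable arF arR memA u)
    (h : ∀ prev : List ℕ, p ∈ prev → q ∈ prev → u ∈ prev →
      lineOK arF arR memA prev (j :: p :: q :: u :: extra) = true) :
    Certifiable arF arR memA j :=
  Certifiable.step [p, q, u] j (p :: q :: u :: extra) (by simp [hp, hq, hu]) fun prev hprev =>
    h prev (hprev p (by simp)) (hprev q (by simp)) (hprev u (by simp))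

/-- Step with four premises (fields `1, 2, 3, 4`). [folklore] -/
theorem Certifiable.step4 (j : ℕ) (extra : List ℕ) {p q u w : ℕ} (hp : Certifiable arF arR memA p)
    (hq : Certifiable arF arR memA q) (hu : Certifiable arF arR memA u)
    (hw : Certifiable arF arR memA w)
    (h : ∀ prev : List ℕ, p ∈ prev → q ∈ prev → u ∈ prev → w ∈ prev →
      lineOK arF arR memA prev (j :: p :: q :: u :: w :: extra) = true) :
    Certifiable arF arR memA j :=
  Certifiable.step [p, q, u, w] j (p :: q :: u :: w :: extra) (by simp [hp, hq, hu, hw])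
    fun prev hprev =>
    h prev (hprev p (by simp)) (hprev q (by simp)) (hprev u (by simp)) (hprev w (by simp))

/-- A line passing a pure rule is accepted. [folklore] -/
theorem lineOK_of_pure {prev line : List ℕ} (r : Rule) (hr : r ∈ Rules.pure)
    (h : r.ok prev line = true) : lineOK arF arR memA prev line = true := by
  unfold lineOK
  simp only [Bool.or_eq_true]
  exact Or.inl (Or.inl (Or.inl ((anyOK_iff _ _ _).2 ⟨r, hr, h⟩)))

/-- A line passing `mtFunc` and its oracle condition is accepted. [folklore] -/
theorem lineOK_of_mtFunc {prev line : List ℕ} (h : Rules.mtFunc.ok prev line = true)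
    (hC : arF (line.getI 2) = some (jB (line.getI 1))) : lineOK arF arR memA prev line = true := by
  unfold lineOK
  simp only [Bool.or_eq_true, Bool.and_eq_true, decide_eq_true_eq]
  exact Or.inl (Or.inl (Or.inr ⟨h, hC⟩))

/-- A line passing `mlRel` and its oracle condition is accepted. [folklore] -/
theorem lineOK_of_mlRel {prev line : List ℕ} (h : Rules.mlRel.ok prev line = true)
    (hC : arR (line.getI 2) = some (jB (line.getI 1))) : lineOK arF arR memA prev line = true := by
  unfold lineOK
  simp only [Bool.or_eq_true, Bool.and_eq_true, decide_eq_true_eq]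
  exact Or.inl (Or.inr ⟨h, hC⟩)

/-- A line passing `pfHyp` and its oracle condition is accepted. [folklore] -/
theorem lineOK_of_pfHyp {prev line : List ℕ} (h : Rules.pfHyp.ok prev line = true)
    (hC : memA (jC (line.getI 1)) = true) : lineOK arF arR memA prev line = true := by
  unfold lineOK
  simp only [Bool.or_eq_true, Bool.and_eq_true]
  exact Or.inr ⟨h, hC⟩

end Certifiable

/-! ### Certificates for the syntactic judgements -/

section Syntax

variable {arF arR : ℕ → Option ℕ} {memA : ℕ → Bool}

open Rules

/-- Certificates for lifting pre-terms. [folklore] -/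
theorem cert_liftT (m : ℕ) : ∀ t : PreTerm,
    Certifiable arF arR memA (Jn 0 m t.code (t.liftAt m).code 0)
  | PreTerm.var i => by
      refine Certifiable.step0 _ [m, i] fun prev => lineOK_of_pure ltVar (by simp [Rules.pure]) ?_
      by_cases h : i < m <;>
        simp only [ltVar, Rule.ok, premsOK, eqsOK, Bool.true_and, Bool.and_true, beq_iff_eq,
          Tm.eval_jn, Tm.eval_varT, Tm.eval_fld, Tm.eval_cst, Tm.eval_add, Tm.eval_iteLt,
          List.getI_cons_zero, List.getI_cons_succ] <;>
        simp [PreTerm.code, PreTerm.liftAt, h]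
  | PreTerm.param c => by
      refine Certifiable.step0 _ [m, c] fun prev => lineOK_of_pure ltParam (by simp [Rules.pure]) ?_
      simp only [ltParam, Rule.ok, premsOK, eqsOK, Bool.true_and, Bool.and_true, beq_iff_eq,
        Tm.eval_jn, Tm.eval_paramT, Tm.eval_fld, Tm.eval_cst, List.getI_cons_zero,
        List.getI_cons_succ]
      simp [PreTerm.code, PreTerm.liftAt]
  | PreTerm.func f a => by
      refine Certifiable.step1 _ [f] (cert_liftT m a)
        fun prev hp => lineOK_of_pure ltFunc (by simp [Rules.pure]) ?_
      simp only [ltFunc, Rule.ok, premsOK, eqsOK, Bool.and_eq_true, Bool.true_and, Bool.and_true,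
        decide_eq_true_eq, beq_iff_eq, Tm.eval_jn, Tm.eval_kd, Tm.eval_p1, Tm.eval_p2, Tm.eval_p3,
        Tm.eval_funcT, Tm.eval_fld, Tm.eval_cst, true_and, List.getI_cons_zero, List.getI_cons_succ,
        jK_Jn, jA_Jn, jB_Jn, jC_Jn, zero_add]
      simp only [hp]
      simp [PreTerm.code, PreTerm.liftAt]
  | PreTerm.nil => by
      refine Certifiable.step0 _ [m] fun prev => lineOK_of_pure ltNil (by simp [Rules.pure]) ?_
      simp only [ltNil, Rule.ok, premsOK, eqsOK, Bool.true_and, Bool.and_true, beq_iff_eq,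
        Tm.eval_jn, Tm.eval_fld, Tm.eval_cst, List.getI_cons_zero, List.getI_cons_succ]
      simp [PreTerm.code, PreTerm.liftAt]
  | PreTerm.cons t r => by
      refine Certifiable.step2 _ [] (cert_liftT m t) (cert_liftT m r) fun prev hp hq => lineOK_of_pure ltCons (by simp [Rules.pure]) ?_
      simp only [ltCons, Rule.ok, premsOK, eqsOK, Bool.and_eq_true, Bool.true_and, Bool.and_true,
        decide_eq_true_eq, beq_iff_eq, Tm.eval_jn, Tm.eval_kd, Tm.eval_p1, Tm.eval_p2, Tm.eval_p3,
        Tm.eval_consT, Tm.eval_fld, Tm.eval_cst, true_and, List.getI_cons_zero, List.getI_cons_succ,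
        jK_Jn, jA_Jn, jB_Jn, jC_Jn, zero_add, Nat.reduceAdd]
      simp only [hp, hq]
      simp [PreTerm.code, PreTerm.liftAt]

/-- Certificates for lifting pre-formulas. [folklore] -/
theorem cert_liftF (m : ℕ) : ∀ φ : PreFormula,
    Certifiable arF arR memA (Jn 1 m φ.code (φ.liftAt m).code 0)
  | PreFormula.falsum => by
      refine Certifiable.step0 _ [m] fun prev => lineOK_of_pure lfFalsum (by simp [Rules.pure]) ?_
      simp only [lfFalsum, Rule.ok, premsOK, eqsOK, Bool.true_and, Bool.and_true, beq_iff_eq,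
        Tm.eval_jn, Tm.eval_fld, Tm.eval_cst, List.getI_cons_zero, List.getI_cons_succ]
      simp [PreFormula.code, PreFormula.liftAt]
  | PreFormula.equal t₁ t₂ => by
      refine Certifiable.step2 _ [] (cert_liftT m t₁) (cert_liftT m t₂) fun prev hp hq => lineOK_of_pure lfEqual (by simp [Rules.pure]) ?_
      simp only [lfEqual, Rule.ok, premsOK, eqsOK, Bool.and_eq_true, Bool.true_and, Bool.and_true,
        decide_eq_true_eq, beq_iff_eq, Tm.eval_jn, Tm.eval_kd, Tm.eval_p1, Tm.eval_p2, Tm.eval_p3,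
        Tm.eval_equalT, Tm.eval_fld, Tm.eval_cst, true_and, List.getI_cons_zero,
        List.getI_cons_succ, jK_Jn, jA_Jn, jB_Jn, jC_Jn, zero_add, Nat.reduceAdd]
      simp only [hp, hq]
      simp [PreFormula.code, PreFormula.liftAt]
  | PreFormula.rel r a => by
      refine Certifiable.step1 _ [r] (cert_liftT m a)
        fun prev hp => lineOK_of_pure lfRel (by simp [Rules.pure]) ?_
      simp only [lfRel, Rule.ok, premsOK, eqsOK, Bool.and_eq_true, Bool.true_and, Bool.and_true,
        decide_eq_true_eq, beq_iff_eq, Tm.eval_jn, Tm.eval_kd, Tm.eval_p1, Tm.eval_p2, Tm.eval_p3,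
        Tm.eval_relT, Tm.eval_fld, Tm.eval_cst, true_and, List.getI_cons_zero, List.getI_cons_succ,
        jK_Jn, jA_Jn, jB_Jn, jC_Jn, zero_add]
      simp only [hp]
      simp [PreFormula.code, PreFormula.liftAt]
  | PreFormula.imp φ ψ => by
      refine Certifiable.step2 _ [] (cert_liftF m φ) (cert_liftF m ψ) fun prev hp hq => lineOK_of_pure lfImp (by simp [Rules.pure]) ?_
      simp only [lfImp, Rule.ok, premsOK, eqsOK, Bool.and_eq_true, Bool.true_and, Bool.and_true,
        decide_eq_true_eq, beq_iff_eq, Tm.eval_jn, Tm.eval_kd, Tm.eval_p1, Tm.eval_p2, Tm.eval_p3,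
        Tm.eval_impT, Tm.eval_fld, Tm.eval_cst, true_and, List.getI_cons_zero, List.getI_cons_succ,
        jK_Jn, jA_Jn, jB_Jn, jC_Jn, zero_add, Nat.reduceAdd]
      simp only [hp, hq]
      simp [PreFormula.code, PreFormula.liftAt]
  | PreFormula.all φ => by
      refine Certifiable.step1 _ [] (cert_liftF m φ)
        fun prev hp => lineOK_of_pure lfAll (by simp [Rules.pure]) ?_
      simp only [lfAll, Rule.ok, premsOK, eqsOK, Bool.and_eq_true, Bool.true_and, Bool.and_true,
        decide_eq_true_eq, beq_iff_eq, Tm.eval_jn, Tm.eval_kd, Tm.eval_p1, Tm.eval_p2, Tm.eval_p3,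
        Tm.eval_allT, Tm.eval_fld, Tm.eval_cst, true_and, List.getI_cons_zero, List.getI_cons_succ,
        jK_Jn, jA_Jn, jB_Jn, jC_Jn, zero_add]
      simp only [hp]
      simp [PreFormula.code, PreFormula.liftAt]

/-- Certificates for instances of pre-terms. [folklore] -/
theorem cert_instT (m : ℕ) (s : PreTerm) : ∀ t : PreTerm,
    Certifiable arF arR memA (Jn 2 m s.code t.code (t.inst m s).code)
  | PreTerm.var i => by
      refine Certifiable.step0 _ [m, s.code, i] fun prev => lineOK_of_pure itVar (by simp [Rules.pure]) ?_
      by_cases h1 : i < m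
      · simp only [itVar, Rule.ok, premsOK, eqsOK, Bool.true_and, Bool.and_true, beq_iff_eq,
        Tm.eval_jn, Tm.eval_varT, Tm.eval_fld, Tm.eval_cst, Tm.eval_sub, Tm.eval_iteLt,
        Tm.eval_iteEq, List.getI_cons_zero, List.getI_cons_succ]
        simp [PreTerm.code, PreTerm.inst, h1]
      · by_cases h2 : i = m
        · subst h2
          simp only [itVar, Rule.ok, premsOK, eqsOK, Bool.true_and, Bool.and_true, beq_iff_eq,
            Tm.eval_jn, Tm.eval_varT, Tm.eval_fld, Tm.eval_cst, Tm.eval_sub, Tm.eval_iteLt,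
            Tm.eval_iteEq, List.getI_cons_zero, List.getI_cons_succ]
          simp [PreTerm.code, PreTerm.inst]
        · simp only [itVar, Rule.ok, premsOK, eqsOK, Bool.true_and, Bool.and_true, beq_iff_eq,
          Tm.eval_jn, Tm.eval_varT, Tm.eval_fld, Tm.eval_cst, Tm.eval_sub, Tm.eval_iteLt,
          Tm.eval_iteEq, List.getI_cons_zero, List.getI_cons_succ]
          simp [PreTerm.code, PreTerm.inst, h1, h2]
  | PreTerm.param c => by
      refine Certifiable.step0 _ [m, s.code, c] fun prev => lineOK_of_pure itParam (by simp [Rules.pure]) ?_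
      simp only [itParam, Rule.ok, premsOK, eqsOK, Bool.true_and, Bool.and_true, beq_iff_eq,
        Tm.eval_jn, Tm.eval_paramT, Tm.eval_fld, List.getI_cons_zero, List.getI_cons_succ]
      simp [PreTerm.code, PreTerm.inst]
  | PreTerm.func f a => by
      refine Certifiable.step1 _ [f] (cert_instT m s a)
        fun prev hp => lineOK_of_pure itFunc (by simp [Rules.pure]) ?_
      simp only [itFunc, Rule.ok, premsOK, eqsOK, Bool.and_eq_true, Bool.true_and, Bool.and_true,
        decide_eq_true_eq, beq_iff_eq, Tm.eval_jn, Tm.eval_kd, Tm.eval_p1, Tm.eval_p2, Tm.eval_p3,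
        Tm.eval_p4, Tm.eval_funcT, Tm.eval_fld, Tm.eval_cst, true_and, List.getI_cons_zero,
        List.getI_cons_succ, jK_Jn, jA_Jn, jB_Jn, jC_Jn, jD_Jn, zero_add]
      simp only [hp]
      simp [PreTerm.code, PreTerm.inst]
  | PreTerm.nil => by
      refine Certifiable.step0 _ [m, s.code] fun prev => lineOK_of_pure itNil (by simp [Rules.pure]) ?_
      simp only [itNil, Rule.ok, premsOK, eqsOK, Bool.true_and, Bool.and_true, beq_iff_eq,
        Tm.eval_jn, Tm.eval_fld, Tm.eval_cst, List.getI_cons_zero, List.getI_cons_succ]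
      simp [PreTerm.code, PreTerm.inst]
  | PreTerm.cons t r => by
      refine Certifiable.step2 _ [] (cert_instT m s t) (cert_instT m s r) fun prev hp hq => lineOK_of_pure itCons (by simp [Rules.pure]) ?_
      simp only [itCons, Rule.ok, premsOK, eqsOK, Bool.and_eq_true, Bool.true_and, Bool.and_true,
        decide_eq_true_eq, beq_iff_eq, Tm.eval_jn, Tm.eval_kd, Tm.eval_p1, Tm.eval_p2, Tm.eval_p3,
        Tm.eval_p4, Tm.eval_consT, Tm.eval_fld, Tm.eval_cst, true_and, List.getI_cons_zero,
        List.getI_cons_succ, jK_Jn, jA_Jn, jB_Jn, jC_Jn, jD_Jn, zero_add, Nat.reduceAdd]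
      simp only [hp, hq]
      simp [PreTerm.code, PreTerm.inst]

/-- Certificates for instances of pre-formulas. [folklore] -/
theorem cert_instF (m : ℕ) (s : PreTerm) : ∀ φ : PreFormula,
    Certifiable arF arR memA (Jn 3 m s.code φ.code (φ.inst m s).code)
  | PreFormula.falsum => by
      refine Certifiable.step0 _ [m, s.code] fun prev => lineOK_of_pure ifFalsum (by simp [Rules.pure]) ?_
      simp only [ifFalsum, Rule.ok, premsOK, eqsOK, Bool.true_and, Bool.and_true, beq_iff_eq,
        Tm.eval_jn, Tm.eval_fld, Tm.eval_cst, List.getI_cons_zero, List.getI_cons_succ]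
      simp [PreFormula.code, PreFormula.inst]
  | PreFormula.equal t₁ t₂ => by
      refine Certifiable.step2 _ [] (cert_instT m s t₁) (cert_instT m s t₂) fun prev hp hq => lineOK_of_pure ifEqual (by simp [Rules.pure]) ?_
      simp only [ifEqual, Rule.ok, premsOK, eqsOK, Bool.and_eq_true, Bool.true_and, Bool.and_true,
        decide_eq_true_eq, beq_iff_eq, Tm.eval_jn, Tm.eval_kd, Tm.eval_p1, Tm.eval_p2, Tm.eval_p3,
        Tm.eval_p4, Tm.eval_equalT, Tm.eval_fld, Tm.eval_cst, true_and, List.getI_cons_zero,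
        List.getI_cons_succ, jK_Jn, jA_Jn, jB_Jn, jC_Jn, jD_Jn, zero_add, Nat.reduceAdd]
      simp only [hp, hq]
      simp [PreFormula.code, PreFormula.inst]
  | PreFormula.rel r a => by
      refine Certifiable.step1 _ [r] (cert_instT m s a)
        fun prev hp => lineOK_of_pure ifRel (by simp [Rules.pure]) ?_
      simp only [ifRel, Rule.ok, premsOK, eqsOK, Bool.and_eq_true, Bool.true_and, Bool.and_true,
        decide_eq_true_eq, beq_iff_eq, Tm.eval_jn, Tm.eval_kd, Tm.eval_p1, Tm.eval_p2, Tm.eval_p3,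
        Tm.eval_p4, Tm.eval_relT, Tm.eval_fld, Tm.eval_cst, true_and, List.getI_cons_zero,
        List.getI_cons_succ, jK_Jn, jA_Jn, jB_Jn, jC_Jn, jD_Jn, zero_add]
      simp only [hp]
      simp [PreFormula.code, PreFormula.inst]
  | PreFormula.imp φ ψ => by
      refine Certifiable.step2 _ [] (cert_instF m s φ) (cert_instF m s ψ) fun prev hp hq => lineOK_of_pure ifImp (by simp [Rules.pure]) ?_
      simp only [ifImp, Rule.ok, premsOK, eqsOK, Bool.and_eq_true, Bool.true_and, Bool.and_true,
        decide_eq_true_eq, beq_iff_eq, Tm.eval_jn, Tm.eval_kd, Tm.eval_p1, Tm.eval_p2, Tm.eval_p3,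
        Tm.eval_p4, Tm.eval_impT, Tm.eval_fld, Tm.eval_cst, true_and, List.getI_cons_zero,
        List.getI_cons_succ, jK_Jn, jA_Jn, jB_Jn, jC_Jn, jD_Jn, zero_add, Nat.reduceAdd]
      simp only [hp, hq]
      simp [PreFormula.code, PreFormula.inst]
  | PreFormula.all φ => by
      refine Certifiable.step1 _ [] (cert_instF m s φ)
        fun prev hp => lineOK_of_pure ifAll (by simp [Rules.pure]) ?_
      simp only [ifAll, Rule.ok, premsOK, eqsOK, Bool.and_eq_true, Bool.true_and, Bool.and_true,
        decide_eq_true_eq, beq_iff_eq, Tm.eval_jn, Tm.eval_kd, Tm.eval_p1, Tm.eval_p2, Tm.eval_p3,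
        Tm.eval_p4, Tm.eval_allT, Tm.eval_fld, Tm.eval_cst, true_and, List.getI_cons_zero,
        List.getI_cons_succ, jK_Jn, jA_Jn, jB_Jn, jC_Jn, jD_Jn, zero_add]
      simp only [hp]
      simp [PreFormula.code, PreFormula.inst]

/-- Certificates for closedness of pre-terms. [folklore] -/
theorem cert_closed : ∀ t : PreTerm, t.closed = true → Certifiable arF arR memA (Jn 4 t.code 0 0 0)
  | PreTerm.var _, h => by simp [PreTerm.closed] at h
  | PreTerm.param c, _ => by
      refine Certifiable.step0 _ [c] fun prev => lineOK_of_pure clParam (by simp [Rules.pure]) ?_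
      simp only [clParam, Rule.ok, premsOK, eqsOK, Bool.true_and, Bool.and_true, beq_iff_eq,
        Tm.eval_jn, Tm.eval_paramT, Tm.eval_fld, Tm.eval_cst, List.getI_cons_zero,
        List.getI_cons_succ]
      simp [PreTerm.code]
  | PreTerm.func f a, h => by
      refine Certifiable.step1 _ [f] (cert_closed a (by simpa [PreTerm.closed] using h))
        fun prev hp => lineOK_of_pure clFunc (by simp [Rules.pure]) ?_
      simp only [clFunc, Rule.ok, premsOK, eqsOK, Bool.and_eq_true, Bool.true_and, Bool.and_true,
        decide_eq_true_eq, beq_iff_eq, Tm.eval_jn, Tm.eval_kd, Tm.eval_p1, Tm.eval_funcT,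
        Tm.eval_fld, Tm.eval_cst, true_and, List.getI_cons_zero, List.getI_cons_succ, jK_Jn, jA_Jn,
        zero_add]
      simp only [hp]
      simp [PreTerm.code]
  | PreTerm.nil, _ => by
      refine Certifiable.step0 _ [] fun prev => lineOK_of_pure clNil (by simp [Rules.pure]) ?_
      simp only [clNil, Rule.ok, premsOK, eqsOK, Bool.true_and, Bool.and_true, beq_iff_eq,
        Tm.eval_jn, Tm.eval_fld, Tm.eval_cst, List.getI_cons_zero]
      simp [PreTerm.code]
  | PreTerm.cons t r, h => by
      simp only [PreTerm.closed, Bool.and_eq_true] at h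
      refine Certifiable.step2 _ [] (cert_closed t h.1) (cert_closed r h.2)
        fun prev hp hq => lineOK_of_pure clCons (by simp [Rules.pure]) ?_
      simp only [clCons, Rule.ok, premsOK, eqsOK, Bool.and_eq_true, Bool.true_and, Bool.and_true,
        decide_eq_true_eq, beq_iff_eq, Tm.eval_jn, Tm.eval_kd, Tm.eval_p1, Tm.eval_consT,
        Tm.eval_fld, Tm.eval_cst, true_and, List.getI_cons_zero, List.getI_cons_succ, jK_Jn, jA_Jn,
        zero_add, Nat.reduceAdd]
      simp only [hp, hq]
      simp [PreTerm.code]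

/-- Certificates for closed terms. [folklore] -/
theorem cert_closedTerm : ∀ s : PreTerm, s.closedTerm = true →
    Certifiable arF arR memA (Jn 5 s.code 0 0 0)
  | PreTerm.var _, h => by simp [PreTerm.closedTerm] at h
  | PreTerm.param c, _ => by
      refine Certifiable.step0 _ [c] fun prev => lineOK_of_pure ctParam (by simp [Rules.pure]) ?_
      simp only [ctParam, Rule.ok, premsOK, eqsOK, Bool.true_and, Bool.and_true, beq_iff_eq,
        Tm.eval_jn, Tm.eval_paramT, Tm.eval_fld, Tm.eval_cst, List.getI_cons_zero,
        List.getI_cons_succ]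
      simp [PreTerm.code]
  | PreTerm.func f a, h => by
      refine Certifiable.step1 _ [f] (cert_closed a (by simpa [PreTerm.closedTerm] using h))
        fun prev hp => lineOK_of_pure ctFunc (by simp [Rules.pure]) ?_
      simp only [ctFunc, Rule.ok, premsOK, eqsOK, Bool.and_eq_true, Bool.true_and, Bool.and_true,
        decide_eq_true_eq, beq_iff_eq, Tm.eval_jn, Tm.eval_kd, Tm.eval_p1, Tm.eval_funcT,
        Tm.eval_fld, Tm.eval_cst, true_and, List.getI_cons_zero, List.getI_cons_succ, jK_Jn, jA_Jn,
        zero_add]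
      simp only [hp]
      simp [PreTerm.code]
  | PreTerm.nil, h => by simp [PreTerm.closedTerm] at h
  | PreTerm.cons _ _, h => by simp [PreTerm.closedTerm] at h

/-- Certificates for freshness of a parameter in a pre-term. [folklore] -/
theorem cert_freshT (c : ℕ) : ∀ t : PreTerm, c ∉ t.params → Certifiable arF arR memA (Jn 6 c t.code 0 0)
  | PreTerm.var i, _ => by
      refine Certifiable.step0 _ [c, i] fun prev => lineOK_of_pure ntVar (by simp [Rules.pure]) ?_
      simp only [ntVar, Rule.ok, premsOK, eqsOK, Bool.true_and, Bool.and_true, beq_iff_eq,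
        Tm.eval_jn, Tm.eval_varT, Tm.eval_fld, Tm.eval_cst, List.getI_cons_zero,
        List.getI_cons_succ]
      simp [PreTerm.code]
  | PreTerm.param c', h => by
      have hne : c ≠ c' := by simpa [PreTerm.params] using h
      refine Certifiable.step0 _ [c, c'] fun prev => lineOK_of_pure ntParam (by simp [Rules.pure]) ?_
      simp only [ntParam, Rule.ok, premsOK, eqsOK, Bool.and_eq_true, Bool.true_and, Bool.and_true,
        beq_iff_eq, Tm.eval_jn, Tm.eval_paramT, Tm.eval_fld, Tm.eval_cst, Tm.eval_iteEq,
        List.getI_cons_zero, List.getI_cons_succ]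
      simp [PreTerm.code, hne]
  | PreTerm.func f a, h => by
      refine Certifiable.step1 _ [f] (cert_freshT c a (by simpa [PreTerm.params] using h))
        fun prev hp => lineOK_of_pure ntFunc (by simp [Rules.pure]) ?_
      simp only [ntFunc, Rule.ok, premsOK, eqsOK, Bool.and_eq_true, Bool.true_and, Bool.and_true,
        decide_eq_true_eq, beq_iff_eq, Tm.eval_jn, Tm.eval_kd, Tm.eval_p1, Tm.eval_p2,
        Tm.eval_funcT, Tm.eval_fld, Tm.eval_cst, true_and, List.getI_cons_zero, List.getI_cons_succ,
        jK_Jn, jA_Jn, jB_Jn, zero_add]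
      simp only [hp]
      simp [PreTerm.code]
  | PreTerm.nil, _ => by
      refine Certifiable.step0 _ [c] fun prev => lineOK_of_pure ntNil (by simp [Rules.pure]) ?_
      simp only [ntNil, Rule.ok, premsOK, eqsOK, Bool.true_and, Bool.and_true, beq_iff_eq,
        Tm.eval_jn, Tm.eval_fld, Tm.eval_cst, List.getI_cons_zero, List.getI_cons_succ]
      simp [PreTerm.code]
  | PreTerm.cons t r, h => by
      simp only [PreTerm.params, Finset.mem_union, not_or] at h
      refine Certifiable.step2 _ [] (cert_freshT c t h.1) (cert_freshT c r h.2)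
        fun prev hp hq => lineOK_of_pure ntCons (by simp [Rules.pure]) ?_
      simp only [ntCons, Rule.ok, premsOK, eqsOK, Bool.and_eq_true, Bool.true_and, Bool.and_true,
        decide_eq_true_eq, beq_iff_eq, Tm.eval_jn, Tm.eval_kd, Tm.eval_p1, Tm.eval_p2,
        Tm.eval_consT, Tm.eval_fld, Tm.eval_cst, true_and, List.getI_cons_zero, List.getI_cons_succ,
        jK_Jn, jA_Jn, jB_Jn, zero_add, Nat.reduceAdd]
      simp only [hp, hq]
      simp [PreTerm.code]

/-- Certificates for freshness of a parameter in a pre-formula. [folklore] -/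
theorem cert_freshF (c : ℕ) : ∀ φ : PreFormula, c ∉ φ.params → Certifiable arF arR memA (Jn 7 c φ.code 0 0)
  | PreFormula.falsum, _ => by
      refine Certifiable.step0 _ [c] fun prev => lineOK_of_pure nfFalsum (by simp [Rules.pure]) ?_
      simp only [nfFalsum, Rule.ok, premsOK, eqsOK, Bool.true_and, Bool.and_true, beq_iff_eq,
        Tm.eval_jn, Tm.eval_fld, Tm.eval_cst, List.getI_cons_zero, List.getI_cons_succ]
      simp [PreFormula.code]
  | PreFormula.equal t₁ t₂, h => by
      simp only [PreFormula.params, Finset.mem_union, not_or] at h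
      refine Certifiable.step2 _ [] (cert_freshT c t₁ h.1) (cert_freshT c t₂ h.2)
        fun prev hp hq => lineOK_of_pure nfEqual (by simp [Rules.pure]) ?_
      simp only [nfEqual, Rule.ok, premsOK, eqsOK, Bool.and_eq_true, Bool.true_and, Bool.and_true,
        decide_eq_true_eq, beq_iff_eq, Tm.eval_jn, Tm.eval_kd, Tm.eval_p1, Tm.eval_p2,
        Tm.eval_equalT, Tm.eval_fld, Tm.eval_cst, true_and, List.getI_cons_zero,
        List.getI_cons_succ, jK_Jn, jA_Jn, jB_Jn, zero_add, Nat.reduceAdd]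
      simp only [hp, hq]
      simp [PreFormula.code]
  | PreFormula.rel r a, h => by
      refine Certifiable.step1 _ [r] (cert_freshT c a (by simpa [PreFormula.params] using h))
        fun prev hp => lineOK_of_pure nfRel (by simp [Rules.pure]) ?_
      simp only [nfRel, Rule.ok, premsOK, eqsOK, Bool.and_eq_true, Bool.true_and, Bool.and_true,
        decide_eq_true_eq, beq_iff_eq, Tm.eval_jn, Tm.eval_kd, Tm.eval_p1, Tm.eval_p2, Tm.eval_relT,
        Tm.eval_fld, Tm.eval_cst, true_and, List.getI_cons_zero, List.getI_cons_succ, jK_Jn, jA_Jn,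
        jB_Jn, zero_add]
      simp only [hp]
      simp [PreFormula.code]
  | PreFormula.imp φ ψ, h => by
      simp only [PreFormula.params, Finset.mem_union, not_or] at h
      refine Certifiable.step2 _ [] (cert_freshF c φ h.1) (cert_freshF c ψ h.2)
        fun prev hp hq => lineOK_of_pure nfImp (by simp [Rules.pure]) ?_
      simp only [nfImp, Rule.ok, premsOK, eqsOK, Bool.and_eq_true, Bool.true_and, Bool.and_true,
        decide_eq_true_eq, beq_iff_eq, Tm.eval_jn, Tm.eval_kd, Tm.eval_p1, Tm.eval_p2, Tm.eval_impT,
        Tm.eval_fld, Tm.eval_cst, true_and, List.getI_cons_zero, List.getI_cons_succ, jK_Jn, jA_Jn,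
        jB_Jn, zero_add, Nat.reduceAdd]
      simp only [hp, hq]
      simp [PreFormula.code]
  | PreFormula.all φ, h => by
      refine Certifiable.step1 _ [] (cert_freshF c φ (by simpa [PreFormula.params] using h))
        fun prev hp => lineOK_of_pure nfAll (by simp [Rules.pure]) ?_
      simp only [nfAll, Rule.ok, premsOK, eqsOK, Bool.and_eq_true, Bool.true_and, Bool.and_true,
        decide_eq_true_eq, beq_iff_eq, Tm.eval_jn, Tm.eval_kd, Tm.eval_p1, Tm.eval_p2, Tm.eval_allT,
        Tm.eval_fld, Tm.eval_cst, true_and, List.getI_cons_zero, List.getI_cons_succ, jK_Jn, jA_Jn,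
        jB_Jn, zero_add]
      simp only [hp]
      simp [PreFormula.code]

end Syntax

/-! ### Certificates for Mathlib syntax and its Gödel letters -/

section MathlibSyntax

variable {L : Language} [Encodable (Σ i, L.Functions i)] [Encodable (Σ i, L.Relations i)]
variable {arF arR : ℕ → Option ℕ} {memA : ℕ → Bool}

open Rules

omit [Encodable (Σ i, L.Relations i)] in
/-- The code of an application, in the form computed by the rule `mtFunc` from the coded tuple of
the codes of the arguments. [folklore] -/
theorem encode_func_eq {k n : ℕ} (F : L.Functions n) (ts : Fin n → L.Term (Empty ⊕ Fin k)) :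
    encode (Term.func F ts) = encode ((2 * encode (⟨n, F⟩ : Σ i, L.Functions i) + 1) ::
      ofNat (List ℕ) (encode (((ofNat (List ℕ) (encode (List.ofFn fun i => encode (ts i)))).map
        (ofNat (List ℕ))).flatten))) := by
  have h2 : (List.ofFn fun i => encode (ts i)).map (ofNat (List ℕ)) =
      List.ofFn fun i => termLetters (ts i) := by
    rw [List.map_ofFn]
    congr 1
    funext i
    exact ofNat_encode_term (ts i)
  rw [Denumerable.ofNat_encode, Denumerable.ofNat_encode, h2, encode_term_eq, termLetters_func]

/-- The coded letters of an atomic formula, in the form computed by the rule `mlRel`. [folklore] -/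
theorem encode_formulaLetters_rel_eq {k n : ℕ} (R : L.Relations n) (ts : Fin n → L.Term (Empty ⊕ Fin k)) :
    encode (formulaLetters (BoundedFormula.rel R ts)) =
      encode ((4 * encode (⟨n, R⟩ : Σ i, L.Relations i) + 1) :: ofNat (List ℕ) (encode ((4 * k + 3) ::
        ofNat (List ℕ) (encode ((ofNat (List ℕ) (encode (List.ofFn fun i => encode (ts i)))).map
          fun e => 2 * Nat.pair k e))))) := by
  have h2 : (List.ofFn fun i => encode (ts i)).map (fun e => 2 * Nat.pair k e) =
      List.ofFn fun i => 2 * Nat.pair k (encode (ts i)) := by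
    rw [List.map_ofFn]
    rfl
  rw [Denumerable.ofNat_encode, Denumerable.ofNat_encode, Denumerable.ofNat_encode, h2,
    formulaLetters_rel]

omit [Encodable (Σ i, L.Relations i)] in
/-- Certificates for Mathlib argument tuples, given certificates for the entries. [folklore] -/
theorem cert_tuple (k : ℕ) : ∀ {n : ℕ} (g : Fin n → L.Term (Empty ⊕ Fin k)),
    (∀ i, Certifiable arF arR memA (Jn 9 k (PreTerm.ofTerm (g i)).code (encode (g i)) 0)) →
    Certifiable arF arR memA (Jn 10 k n (PreTerm.ofFn fun i => PreTerm.ofTerm (g i)).code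
      (encode (List.ofFn fun i => encode (g i))))
  | 0, g, _ => by
      refine Certifiable.step0 _ [k] fun prev => lineOK_of_pure maNil (by simp [Rules.pure]) ?_
      simp only [maNil, Rule.ok, premsOK, eqsOK, Bool.true_and, Bool.and_true, beq_iff_eq,
        Tm.eval_jn, Tm.eval_fld, Tm.eval_cst, List.getI_cons_zero, List.getI_cons_succ]
      simp [PreTerm.code]
  | n + 1, g, hg => by
      have hq := cert_tuple k (fun i => g i.succ) (fun i => hg i.succ)
      refine Certifiable.step2 _ [] (hg 0) hq fun prev hp hq' => lineOK_of_pure maCons (by simp [Rules.pure]) ?_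
      simp only [maCons, Rule.ok, premsOK, eqsOK, Bool.and_eq_true, Bool.true_and, Bool.and_true,
        decide_eq_true_eq, beq_iff_eq, Tm.eval_jn, Tm.eval_kd, Tm.eval_p1, Tm.eval_p2, Tm.eval_p3,
        Tm.eval_p4, Tm.eval_consT, Tm.eval_fld, Tm.eval_cst, Tm.eval_add, Tm.eval_lcons, true_and,
        List.getI_cons_zero, List.getI_cons_succ, jK_Jn, jA_Jn, jB_Jn, jC_Jn, jD_Jn, zero_add,
        Nat.reduceAdd]
      simp only [hp, hq']
      simp [PreTerm.code, PreTerm.ofFn_succ, List.ofFn_succ]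

omit [Encodable (Σ i, L.Relations i)] in
/-- The code of a variable, in the form computed by `mtVar`. [folklore] -/
theorem encode_var_eq {k : ℕ} (i : Fin k) :
    encode (Term.var (Sum.inr i) : L.Term (Empty ⊕ Fin k)) = encode [4 * i.val + 2] := by
  rw [encode_term_eq, termLetters_var]

omit [Encodable (Σ i, L.Relations i)] in
/-- Certificates for Mathlib terms with their codes (the arity oracle must contain the arity table
of `L`). [folklore] -/
theorem cert_term (harF : ∀ {n} (F : L.Functions n), arF (encode (⟨n, F⟩ : Σ i, L.Functions i)) = some n)
    (k : ℕ) : ∀ t : L.Term (Empty ⊕ Fin k),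
    Certifiable arF arR memA (Jn 9 k (PreTerm.ofTerm t).code (encode t) 0)
  | Term.var (Sum.inr i) => by
      rw [encode_var_eq]
      refine Certifiable.step0 _ [k, i.val] fun prev => lineOK_of_pure mtVar (by simp [Rules.pure]) ?_
      simp only [mtVar, Rule.ok, premsOK, eqsOK, Bool.and_eq_true, Bool.true_and, Bool.and_true,
        beq_iff_eq, Tm.eval_jn, Tm.eval_varT, Tm.eval_lsing, Tm.eval_fld, Tm.eval_cst, Tm.eval_add,
        Tm.eval_mul, Tm.eval_iteLt, List.getI_cons_zero, List.getI_cons_succ]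
      simp [PreTerm.ofTerm, PreTerm.code, i.2]
  | Term.var (Sum.inl e) => e.elim
  | Term.func (l := n) F ts => by
      have hq := cert_tuple (arF := arF) (arR := arR) (memA := memA) k ts (fun i => cert_term harF k (ts i))
      rw [encode_func_eq]
      refine Certifiable.step1 _ [encode (⟨n, F⟩ : Σ i, L.Functions i)] hq
        fun prev hp => lineOK_of_mtFunc ?_ (by simpa using harF F)
      simp only [mtFunc, Rule.ok, premsOK, eqsOK, Bool.and_eq_true, Bool.true_and, Bool.and_true,
        decide_eq_true_eq, beq_iff_eq, Tm.eval_jn, Tm.eval_kd, Tm.eval_p1, Tm.eval_p3, Tm.eval_p4,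
        Tm.eval_funcT, Tm.eval_fld, Tm.eval_cst, Tm.eval_add, Tm.eval_mul, Tm.eval_lcons,
        Tm.eval_lflat, true_and, List.getI_cons_zero, List.getI_cons_succ, jK_Jn, jA_Jn, jC_Jn,
        jD_Jn, zero_add]
      simp only [hp]
      simp [PreTerm.ofTerm, PreTerm.code]

/-- Certificates for Mathlib bounded formulas with their Gödel letters (the arity oracles must
contain the arity tables of `L`). [folklore] -/
theorem cert_formula (harF : ∀ {n} (F : L.Functions n), arF (encode (⟨n, F⟩ : Σ i, L.Functions i)) = some n)
    (harR : ∀ {n} (R : L.Relations n), arR (encode (⟨n, R⟩ : Σ i, L.Relations i)) = some n) :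
    ∀ {k : ℕ} (ψ : L.BoundedFormula Empty k),
    Certifiable arF arR memA (Jn 11 k (PreFormula.ofBounded ψ).code (encode (formulaLetters ψ)) 0)
  | k, BoundedFormula.falsum => by
      rw [formulaLetters_falsum]
      refine Certifiable.step0 _ [k] fun prev => lineOK_of_pure mlFalsum (by simp [Rules.pure]) ?_
      simp only [mlFalsum, Rule.ok, premsOK, eqsOK, Bool.true_and, Bool.and_true, beq_iff_eq,
        Tm.eval_jn, Tm.eval_lsing, Tm.eval_fld, Tm.eval_cst, Tm.eval_add, Tm.eval_mul,
        List.getI_cons_zero, List.getI_cons_succ]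
      simp [PreFormula.ofBounded, PreFormula.code]
  | k, BoundedFormula.equal t₁ t₂ => by
      rw [formulaLetters_equal]
      refine Certifiable.step2 _ [] (cert_term harF k t₁) (cert_term harF k t₂)
        fun prev hp hq => lineOK_of_pure mlEqual (by simp [Rules.pure]) ?_
      simp only [mlEqual, Rule.ok, premsOK, eqsOK, Bool.and_eq_true, Bool.true_and, Bool.and_true,
        decide_eq_true_eq, beq_iff_eq, Tm.eval_jn, Tm.eval_kd, Tm.eval_p1, Tm.eval_p2, Tm.eval_p3,
        Tm.eval_equalT, Tm.eval_lsing, Tm.eval_fld, Tm.eval_cst, Tm.eval_mul, Tm.eval_pair,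
        Tm.eval_lcons, true_and, List.getI_cons_zero, List.getI_cons_succ, jK_Jn, jA_Jn, jB_Jn,
        jC_Jn, zero_add, Nat.reduceAdd]
      simp only [hp, hq]
      simp [PreFormula.ofBounded, PreFormula.code]
  | k, BoundedFormula.rel (l := n) R ts => by
      have hq := cert_tuple (arF := arF) (arR := arR) (memA := memA) k ts (fun i => cert_term harF k (ts i))
      rw [encode_formulaLetters_rel_eq]
      refine Certifiable.step1 _ [encode (⟨n, R⟩ : Σ i, L.Relations i)] hq
        fun prev hp => lineOK_of_mlRel ?_ (by simpa using harR R)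
      simp only [mlRel, Rule.ok, premsOK, eqsOK, Bool.and_eq_true, Bool.true_and, Bool.and_true,
        decide_eq_true_eq, beq_iff_eq, Tm.eval_jn, Tm.eval_kd, Tm.eval_p1, Tm.eval_p3, Tm.eval_p4,
        Tm.eval_relT, Tm.eval_fld, Tm.eval_cst, Tm.eval_add, Tm.eval_mul, Tm.eval_lcons,
        Tm.eval_lmapArg, true_and, List.getI_cons_zero, List.getI_cons_succ, jK_Jn, jA_Jn, jC_Jn,
        jD_Jn, zero_add]
      simp only [hp]
      simp [PreFormula.ofBounded, PreFormula.code]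
  | k, BoundedFormula.imp φ ψ => by
      rw [formulaLetters_imp]
      refine Certifiable.step2 _ [] (cert_formula harF harR φ) (cert_formula harF harR ψ)
        fun prev hp hq => lineOK_of_pure mlImp (by simp [Rules.pure]) ?_
      simp only [mlImp, Rule.ok, premsOK, eqsOK, Bool.and_eq_true, Bool.true_and, Bool.and_true,
        decide_eq_true_eq, beq_iff_eq, Tm.eval_jn, Tm.eval_kd, Tm.eval_p1, Tm.eval_p2, Tm.eval_p3,
        Tm.eval_impT, Tm.eval_fld, Tm.eval_cst, Tm.eval_lcons, Tm.eval_lappend, true_and,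
        List.getI_cons_zero, List.getI_cons_succ, jK_Jn, jA_Jn, jB_Jn, jC_Jn, zero_add,
        Nat.reduceAdd]
      simp only [hp, hq]
      simp [PreFormula.ofBounded, PreFormula.code]
  | k, BoundedFormula.all φ => by
      rw [formulaLetters_all]
      refine Certifiable.step1 _ [k] (cert_formula harF harR φ)
        fun prev hp => lineOK_of_pure mlAll (by simp [Rules.pure]) ?_
      simp only [mlAll, Rule.ok, premsOK, eqsOK, Bool.and_eq_true, Bool.true_and, Bool.and_true,
        decide_eq_true_eq, beq_iff_eq, Tm.eval_jn, Tm.eval_kd, Tm.eval_p1, Tm.eval_p2, Tm.eval_p3,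
        Tm.eval_allT, Tm.eval_fld, Tm.eval_cst, Tm.eval_add, Tm.eval_lcons, true_and,
        List.getI_cons_zero, List.getI_cons_succ, jK_Jn, jA_Jn, jB_Jn, jC_Jn, zero_add]
      simp only [hp]
      simp [PreFormula.ofBounded, PreFormula.code]

end MathlibSyntax

/-! ### Certificates for derivations and theorems -/

section Derivations

variable {L : Language} [Encodable (Σ i, L.Functions i)] [Encodable (Σ i, L.Relations i)]
variable {arF arR : ℕ → Option ℕ} {memA : ℕ → Bool}

open Rules

/-- **Certificates for derivations**: every derivation whose hypotheses are translations of
sentences accepted by the axiom oracle can be replayed by the checker. [folklore] -/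
theorem cert_derives
    (harF : ∀ {n} (F : L.Functions n), arF (encode (⟨n, F⟩ : Σ i, L.Functions i)) = some n)
    (harR : ∀ {n} (R : L.Relations n), arR (encode (⟨n, R⟩ : Σ i, L.Relations i)) = some n)
    {U : List PreFormula} {φ : PreFormula} (hd : Derives U φ)
    (hU : ∀ ψ ∈ U, ∃ χ : L.Sentence, PreFormula.ofBounded χ = ψ ∧ memA (encode χ) = true) :
    Certifiable arF arR memA (Jn 8 φ.code 0 0 0) := by
  induction hd with
  | hyp φ =>
      obtain ⟨χ, rfl, hχ⟩ := hU φ (by simp)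
      refine Certifiable.step1 _ [] (cert_formula harF harR χ)
        fun prev hp => lineOK_of_pfHyp ?_ ?_
      · simp only [pfHyp, Rule.ok, premsOK, eqsOK, Bool.and_eq_true, Bool.true_and, Bool.and_true,
        decide_eq_true_eq, beq_iff_eq, Tm.eval_jn, Tm.eval_kd, Tm.eval_p1, Tm.eval_p2, Tm.eval_fld,
        Tm.eval_cst, and_true, List.getI_cons_zero, List.getI_cons_succ, jK_Jn, jA_Jn, jB_Jn,
        zero_add, and_self]
        simp [hp]
      · simpa [encode_sentence_eq, jC_Jn] using hχ
  | p1 φ ψ =>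
      refine Certifiable.step0 _ [φ.code, ψ.code] fun prev => lineOK_of_pure pfP1 (by simp [Rules.pure]) ?_
      simp only [pfP1, Rule.ok, premsOK, eqsOK, Bool.true_and, Bool.and_true, beq_iff_eq,
        Tm.eval_jn, Tm.eval_impT, Tm.eval_fld, Tm.eval_cst, List.getI_cons_zero,
        List.getI_cons_succ]
      simp [PreFormula.code]
  | p2 φ ψ χ =>
      refine Certifiable.step0 _ [φ.code, ψ.code, χ.code] fun prev => lineOK_of_pure pfP2 (by simp [Rules.pure]) ?_
      simp only [pfP2, Rule.ok, premsOK, eqsOK, Bool.true_and, Bool.and_true, beq_iff_eq,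
        Tm.eval_jn, Tm.eval_impT, Tm.eval_fld, Tm.eval_cst, List.getI_cons_zero,
        List.getI_cons_succ]
      simp [PreFormula.code]
  | p3 φ =>
      refine Certifiable.step0 _ [φ.code] fun prev => lineOK_of_pure pfP3 (by simp [Rules.pure]) ?_
      simp only [pfP3, Rule.ok, premsOK, eqsOK, Bool.true_and, Bool.and_true, beq_iff_eq,
        Tm.eval_jn, Tm.eval_impT, Tm.eval_fld, Tm.eval_cst, List.getI_cons_zero,
        List.getI_cons_succ]
      simp [PreFormula.code]
  | @q1 φ s hs =>
      refine Certifiable.step2 _ [] (cert_instF 0 s φ) (cert_closedTerm s hs)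
        fun prev hp hq => lineOK_of_pure pfQ1 (by simp [Rules.pure]) ?_
      simp only [pfQ1, Rule.ok, premsOK, eqsOK, Bool.and_eq_true, Bool.true_and, Bool.and_true,
        decide_eq_true_eq, beq_iff_eq, Tm.eval_jn, Tm.eval_kd, Tm.eval_p1, Tm.eval_p2, Tm.eval_p3,
        Tm.eval_p4, Tm.eval_impT, Tm.eval_allT, Tm.eval_fld, Tm.eval_cst, true_and,
        List.getI_cons_zero, List.getI_cons_succ, jK_Jn, jA_Jn, jB_Jn, jC_Jn, jD_Jn, zero_add,
        Nat.reduceAdd]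
      simp only [hp, hq]
      simp [PreFormula.code]
  | q2 φ ψ =>
      refine Certifiable.step0 _ [φ.code, ψ.code] fun prev => lineOK_of_pure pfQ2 (by simp [Rules.pure]) ?_
      simp only [pfQ2, Rule.ok, premsOK, eqsOK, Bool.true_and, Bool.and_true, beq_iff_eq,
        Tm.eval_jn, Tm.eval_impT, Tm.eval_allT, Tm.eval_fld, Tm.eval_cst, List.getI_cons_zero,
        List.getI_cons_succ]
      simp [PreFormula.code]
  | q3 φ =>
      refine Certifiable.step1 _ [] (cert_liftF 0 φ)
        fun prev hp => lineOK_of_pure pfQ3 (by simp [Rules.pure]) ?_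
      simp only [pfQ3, Rule.ok, premsOK, eqsOK, Bool.and_eq_true, Bool.true_and, Bool.and_true,
        decide_eq_true_eq, beq_iff_eq, Tm.eval_jn, Tm.eval_kd, Tm.eval_p1, Tm.eval_p2, Tm.eval_p3,
        Tm.eval_impT, Tm.eval_allT, Tm.eval_fld, Tm.eval_cst, true_and, List.getI_cons_zero,
        List.getI_cons_succ, jK_Jn, jA_Jn, jB_Jn, jC_Jn, zero_add]
      simp only [hp]
      simp [PreFormula.code]
  | e1 t =>
      refine Certifiable.step0 _ [t.code] fun prev => lineOK_of_pure pfE1 (by simp [Rules.pure]) ?_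
      simp only [pfE1, Rule.ok, premsOK, eqsOK, Bool.true_and, Bool.and_true, beq_iff_eq,
        Tm.eval_jn, Tm.eval_equalT, Tm.eval_fld, Tm.eval_cst, List.getI_cons_zero,
        List.getI_cons_succ]
      simp [PreFormula.code]
  | @e2 φ s t hs ht =>
      refine Certifiable.step4 _ [] (cert_instF 0 s φ) (cert_instF 0 t φ) (cert_closedTerm s hs)
        (cert_closedTerm t ht)
        fun prev hp hq hu hw => lineOK_of_pure pfE2 (by simp [Rules.pure]) ?_
      simp only [pfE2, Rule.ok, premsOK, eqsOK, Bool.and_eq_true, Bool.true_and, Bool.and_true,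
        decide_eq_true_eq, beq_iff_eq, Tm.eval_jn, Tm.eval_kd, Tm.eval_p1, Tm.eval_p2, Tm.eval_p3,
        Tm.eval_p4, Tm.eval_equalT, Tm.eval_impT, Tm.eval_fld, Tm.eval_cst, true_and,
        List.getI_cons_zero, List.getI_cons_succ, jK_Jn, jA_Jn, jB_Jn, jC_Jn, jD_Jn, zero_add,
        Nat.reduceAdd]
      simp only [hp, hq, hu, hw]
      simp [PreFormula.code]
  | @mp U V φ ψ _ _ ih₁ ih₂ =>
      have h₁ := ih₁ fun χ hχ => hU χ (List.mem_append_left _ hχ)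
      have h₂ := ih₂ fun χ hχ => hU χ (List.mem_append_right _ hχ)
      refine Certifiable.step2 _ [ψ.code] h₁ h₂
        fun prev hp hq => lineOK_of_pure pfMP (by simp [Rules.pure]) ?_
      simp only [pfMP, Rule.ok, premsOK, eqsOK, Bool.and_eq_true, Bool.true_and, Bool.and_true,
        decide_eq_true_eq, beq_iff_eq, Tm.eval_jn, Tm.eval_kd, Tm.eval_p1, Tm.eval_impT,
        Tm.eval_fld, Tm.eval_cst, true_and, and_true, List.getI_cons_zero, List.getI_cons_succ,
        jK_Jn, jA_Jn, zero_add, Nat.reduceAdd]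
      simp only [hp, hq]
      simp [PreFormula.code]
  | @gen U φ c _ hc _ ih =>
      have h₁ := ih hU
      refine Certifiable.step3 _ [c] h₁ (cert_instF 0 (PreTerm.param c) φ) (cert_freshF c φ hc)
        fun prev hp hq hu => lineOK_of_pure pfGen (by simp [Rules.pure]) ?_
      simp only [pfGen, Rule.ok, premsOK, eqsOK, Bool.and_eq_true, Bool.true_and, Bool.and_true,
        decide_eq_true_eq, beq_iff_eq, Tm.eval_jn, Tm.eval_kd, Tm.eval_p1, Tm.eval_p2, Tm.eval_p3,
        Tm.eval_p4, Tm.eval_paramT, Tm.eval_allT, Tm.eval_fld, Tm.eval_cst, true_and,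
        List.getI_cons_zero, List.getI_cons_succ, jK_Jn, jA_Jn, jB_Jn, jC_Jn, jD_Jn, zero_add,
        Nat.reduceAdd]
      simp only [hp, hq, hu]
      simp [PreFormula.code, PreTerm.code]

/-- **Certificates for theorems**: if the translation of a sentence `φ` is derivable from
translations of sentences accepted by the axiom oracle, then the judgement
"`encode φ` is a theorem" is certifiable. [folklore] -/
theorem cert_thm
    (harF : ∀ {n} (F : L.Functions n), arF (encode (⟨n, F⟩ : Σ i, L.Functions i)) = some n)
    (harR : ∀ {n} (R : L.Relations n), arR (encode (⟨n, R⟩ : Σ i, L.Relations i)) = some n)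
    {S : Set PreFormula} (hS : ∀ ψ ∈ S, ∃ χ : L.Sentence, PreFormula.ofBounded χ = ψ ∧ memA (encode χ) = true)
    {φ : L.Sentence} (h : Provable S (PreFormula.ofBounded φ)) :
    Certifiable arF arR memA (Jn 12 (encode φ) 0 0 0) := by
  obtain ⟨U, hU, hd⟩ := h
  have h₁ := cert_derives harF harR hd (fun ψ hψ => hS ψ (hU ψ hψ))
  have h₂ := cert_formula (memA := memA) harF harR φ
  rw [encode_sentence_eq]
  refine Certifiable.step2 _ [] h₁ h₂ fun prev hp hq => lineOK_of_pure thm (by simp [Rules.pure]) ?_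
  simp only [thm, Rule.ok, premsOK, eqsOK, Bool.and_eq_true, Bool.true_and, Bool.and_true,
    decide_eq_true_eq, beq_iff_eq, Tm.eval_jn, Tm.eval_kd, Tm.eval_p1, Tm.eval_p2, Tm.eval_p3,
    Tm.eval_fld, Tm.eval_cst, and_true, List.getI_cons_zero, List.getI_cons_succ, jK_Jn, jA_Jn,
    jB_Jn, jC_Jn, zero_add, Nat.reduceAdd, and_self]
  simp [hp, hq]

/-- **Completeness of the checker**: under the hypotheses of `cert_thm`, some certificate for
the Gödel number `encode φ` is accepted. [folklore] -/
theorem exists_check_of_provable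
    (harF : ∀ {n} (F : L.Functions n), arF (encode (⟨n, F⟩ : Σ i, L.Functions i)) = some n)
    (harR : ∀ {n} (R : L.Relations n), arR (encode (⟨n, R⟩ : Σ i, L.Relations i)) = some n)
    {S : Set PreFormula} (hS : ∀ ψ ∈ S, ∃ χ : L.Sentence, PreFormula.ofBounded χ = ψ ∧ memA (encode χ) = true)
    {φ : L.Sentence} (h : Provable S (PreFormula.ofBounded φ)) :
    ∃ c : List (List ℕ), check arF arR memA (encode φ) c = true := by
  obtain ⟨c, hc, hin⟩ := cert_thm harF harR hS h
  exact ⟨c, by rw [check, hc, Bool.true_and, decide_eq_true_eq]; exact hin⟩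

end Derivations

end Literature.ModelTheory.ProofTheory.PreFOL
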